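import Summits.RiemannHypothesis.RiemannHypothesis.Theses.RuelleBand
import Summits.RiemannHypothesis.RiemannHypothesis.Theorems.RuelleBandCofiniteCriticalLineBoundedIndex
import Literature.Analysis.OperatorTheory.KreinLangerDefinitizationProofs
import HarnessLib

/-!
# `BoundedWeilIndex ⟹ CofiniteCriticalLine` — UNCONDITIONAL

Crux `Summit.RiemannHypothesis.RiemannHypothesis.Theses.RuelleBand.CofiniteCriticalLine` (item
stmt-RiemannHypothesis-2064: all but finitely many non-trivial zeros of `ζ` lie on the critical line),
line `cofinite-weil-index-staircase` (continuation lead prover-line-stmt-RiemannHypothesis-2064-c1-0, 2026-08-16).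

The conditional rung `cofiniteCriticalLine_of_boundedWeilIndex_of_krein` (p101979,
`Theorems/RuelleBandCofiniteCriticalLineBoundedIndex.lean`) was stated modulo the named Literature fact
`Literature.Analysis.OperatorTheory.KreinDefinitization` (Kreĭn 1959 / Stewart 1972: a smooth Hermitian function with
at most `κ` negative squares is definitized by `P(-iD) P♯(-iD)`, `deg P ≤ κ`).  That fact is now PROVED in the tree
(`Literature.Analysis.OperatorTheory.KreinDefinitization_holds`,
`Literature/Analysis/OperatorTheory/KreinLangerDefinitizationProofs.lean`: finite-dimensional compressions of the
symmetric difference-quotient operators on point masses + compactness), so the hypothesis is discharged here: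
a UNIFORM bound on the negative index of `Re Q` (`Q = weilQuadratic`) over all windows `[-a, a]` — equivalently a
bound on the negative index of `Re Q` on all compactly supported test functions — implies the crux, with no
hypothesis left.  (The converse, `stub_indexCalibration`, is p104589; the two-sided unconditional equivalence is
recorded in `Theorems/RuelleBandCofiniteCriticalLineBoundedIndexIff.lean`.)
-/

set_option linter.dupNamespace false

noncomputable section

open Complex MeasureTheory Filter Set
open scoped BigOperators Topology ComplexConjugate

namespace Summit.RiemannHypothesis.RiemannHypothesis.Theorems.RuelleBandCofiniteCriticalLine

open Literature.NumberTheory.LFunctions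

/-- **Bounded Weil index ⟹ `CofiniteCriticalLine` (unconditional).**  If there is `N` such that on every
window `[-a, a]` every `(N+1)`-tuple of Weil test functions has a non-zero `ℂ`-combination with
`0 ≤ Re Q` (`Q = weilQuadratic`), then all but finitely many non-trivial zeros of `ζ` lie on the critical line.
The conditional rung `cofiniteCriticalLine_of_boundedWeilIndex_of_krein` with its hypothesis discharged by
`Literature.Analysis.OperatorTheory.KreinDefinitization_holds`. [folklore] -/
theorem cofiniteCriticalLine_of_boundedWeilIndex :
    (∃ N : ℕ, ∀ a : ℝ, ∀ g : Fin (N + 1) → ℝ → ℂ, (∀ i, IsWeilTest (g i)) →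
        (∀ i, tsupport (g i) ⊆ Set.Icc (-a) a) →
        ∃ c : Fin (N + 1) → ℂ, c ≠ 0 ∧ 0 ≤ (weilQuadratic (fun t => ∑ i, c i * g i t)).re) →
    Summit.RiemannHypothesis.RiemannHypothesis.Theses.RuelleBand.CofiniteCriticalLine :=
  cofiniteCriticalLine_of_boundedWeilIndex_of_krein
    Literature.Analysis.OperatorTheory.KreinDefinitization_holds

/-- **Window-free bounded Weil index ⟹ `CofiniteCriticalLine` (unconditional)**: if there is `N` such that
no `(N+1)`-tuple of Weil test functions spans a subspace on which `Re Q` is negative definite, then all but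
finitely many non-trivial zeros of `ζ` lie on the critical line. [folklore] -/
theorem cofiniteCriticalLine_of_boundedWeilIndex' :
    (∃ N : ℕ, ∀ g : Fin (N + 1) → ℝ → ℂ, (∀ i, IsWeilTest (g i)) →
        ∃ c : Fin (N + 1) → ℂ, c ≠ 0 ∧ 0 ≤ (weilQuadratic (fun t => ∑ i, c i * g i t)).re) →
    Summit.RiemannHypothesis.RiemannHypothesis.Theses.RuelleBand.CofiniteCriticalLine :=
  cofiniteCriticalLine_of_boundedWeilIndex_of_krein'
    Literature.Analysis.OperatorTheory.KreinDefinitization_holds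

end Summit.RiemannHypothesis.RiemannHypothesis.Theorems.RuelleBandCofiniteCriticalLine

end
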